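import Summits.BirchSwinnertonDyer.Rank1Residual.Partition.Rows
import Literature.NumberTheory.EllipticCurves.Rank1Residual.Typed.KimCertificate
import HarnessLib

/-!
# X11b (rank `1`, multiplicative `p ≥ 5`): `BSD(E,p)` per pair from ONE unit Kurihara number at a prime level — Kim 2026 Thm. 1.8 at `p ∥ N` (cell `b2b-bsdres`, seat harvest-2 GEN 6)

HONEST FRAMING (cell `b2b-bsdres`, run/shared/lean/b2b/bsd-rank1-residual/, verbatim in every
file): the goal of the cell is to DELETE the COMBINATION-SHAPED residual classes of the
Birch–Swinnerton-Dyer formula for ALL analytic-rank `≤ 1` elliptic curves over `ℚ` — "full BSD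
formula for every rank `≤ 1` curve in class `C`" assembled STRICTLY from published theorems — so
that the rank-`≤ 1` remainder becomes exactly the CONSTRUCTION-SHAPED classes, which are TYPED
(missing-input `Prop`s), NOT attempted. This is not "finishing BSD". Prove what is provable now;
shrink each hard class to its core with data; no claim beyond stated classes.

**What this file proves** (theorems only; no definition, no new named fact). The v5 residual class
X11b is `ClassX11b W p := r_an = 1 ∧ p ≠ 2 ∧ Mult W p ∧ Irr W p` (`Partition/Rows.lean`; RESIDUAL-CASES
§a.2 v5: "NOTHING IN PRINT decides a rank-1 pair at a multiplicative prime with `E[p]` irreducible"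
AS A CLASS). PER PAIR, however, C.-H. Kim, Amer. J. Math. 148 (2026) Thm. 1.8 (= arXiv:2203.12159v4
Thm. 1.9) (1),(4),(6) with Cor. 1.6 — multiplicative reduction is semi-stable, so `ord(δ̃) < ∞`, and
ONE non-zero Kurihara number `δ̃_ℓ` at a PRIME Kolyvagin level witnesses `ord(δ̃) = 1` and
`∂^{(1)}(δ̃) = 0`, whence `length Ш(E/ℚ)[p^∞] = ∂^{(1)} − ∂^{(∞)} = 0` — gives `Ш(E/ℚ)[p^∞] = 0`;
with the lane's exact `#Ш_an = q` a `p`-unit this is Miller's `BSD(E,p)`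
(`Typed.bsdp_of_shaAn_unit_of_noPTorsion`). The x11a seat typed the fact
(`Kim2022_rankOne_card_sha_eq_one_of_kuriharaNumber_ne_zero`, p193395) and the class-agnostic and
`ClassX11` consumers (`Typed/KimCertificate.lean`, p193448); the tree's `ClassX11` excludes the
former-C4 domain `r = 1 ∧ sst ∧ ram(p)` (its third conjunct is `¬Ram ∨ (r = 1 ∧ ¬sst) ∨ (r = 1 ∧ p = 3)`),
which is exactly where the open semistable rank-`1` pairs live. This file supplies the consumer
over the v5 predicate `ClassX11b` (no `Ram`/`sst` conjunct at all), so that the certificate reaches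
EVERY X11b pair at `p ≥ 5` with `ρ̄` onto and `p ∤ #Ш_an`:
* `X11b.bsdp_of_kim_rankOne_of_kuriharaNumber_ne_zero` — `ClassX11b W p`, `5 ≤ p`, `Surj W p`,
  `#Ш_an = q` with `ord_p q = 0`, the newform `f` of `W`, a Kolyvagin prime `ℓ`
  (`Kato.IsKolyvaginPrime W p 1 ℓ`: `ℓ ∤ Np`, `ℓ ≡ 1`, `a_ℓ ≡ ℓ + 1 (mod p)`) with the cyclicity flag
  `#Ẽ(𝔽_ℓ)[p] ≤ p`, a surjective `ψ`, and `δ̃_ℓ ≢ 0 (mod p)` ⇒ `BSDp W p`. Inputs beyond the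
  certificate: Kim's fact (`hKim`), the period transfer at `p ∥ N` (`hϖ` =
  `realPeriodRat_eq_unit_mul_plusPeriod_of_multiplicative`, x11a: Mazur 1978 / GV 2000 Rem. 3.4 —
  the Manin hypothesis of Kim is vacuous at `p ∥ N`, §1.3.5), Gross–Zagier–Kolyvagin (`hGZK`),
  modularity (`hmod`). No (ram), no anticyclotomic main conjecture, no Heegner index, no
  Castella 2018 Thm. A.
* `X11b.sha_primary_trivial_of_kuriharaNumber_ne_zero` — the intermediate `#Ш(E/ℚ)(p) = 1`.

**Where it bites (census; numbers, not adjectives).** X11b ∧ `sst` ∧ `p ≥ 5` residue pairs with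
`N < 2·10⁴` (hyp seat `hyp_bits.tsv` 2026-08-19T18:28Z): 58, of which **7 have `p ∤ ∏c_ℓ · #Ш_an`**
— 11130d1@5, 11305d1@7, 16082a1@11, 16910c1@5, 17170p1@5, 18354c1@7, 18354r1@7 — and carry a unit
`δ̃_ℓ` at the FIRST cyclic Kolyvagin prime (ℓ = 251, 29, 683, 41, 71, 113, 71) by this seat's engine
B (PARI-free modular symbols, farm job j078329; second engine PARI `msfromell` j078325/26/28) —
`b2b-bsdres-harvest-2/census/x11b_r1mult/`. The 3 pairs with `ord_p ∏c_ℓ = 1` (14835f1@5,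
16390q1@5, 19090e1@5) have `δ̃_ℓ ≡ 0` at all 18 computed primes, as Kim's Conjecture 1.10
(`∂^{(∞)} = ord_p ∏c_ℓ`) predicts: outside this lever. The remaining 48 have `ord_p ∏c_ℓ ≥ 1`.
The 85 non-semistable X11b pairs at `p ≥ 5` are closed by the x11c seat's `p`-adic route
(`X11RankOne.bsdp_of_published_of_threeNumbers`); for the 43 of them with `p ∤ ∏c_ℓ·#Ш_an` the
present lever is an INDEPENDENT second route. Per pair; NOT a class theorem; the X11b label is
unchanged (CONSTRUCTION-SHAPED).

References: Kim 2026 [Kim2022StructureSelmer] Thm. 1.9 (6), Cor. 1.6, §1.3.5; Mazur 1978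
[Mazur1978] Cor. 4.1; Miller 2011 [Miller2011LMS] Def. 1.1; cell files
`b2b-bsdres-harvest-2/HARVEST.md` §GEN-6 E26, `b2b-bsdres-x11a/REPORT-g12.md` §5.
-/

noncomputable section

open scoped Classical MatrixGroups ModularForm

open CongruenceSubgroup WeierstrassCurve Literature.NumberTheory.EllipticCurves
  Literature.NumberTheory.EllipticCurves.ModularForms
  Literature.NumberTheory.EllipticCurves.Rank1Residual
  Literature.NumberTheory.EllipticCurves.Rank1Residual.Typed

namespace Summit.BirchSwinnertonDyer.Rank1Residual

variable (W : WeierstrassCurve ℚ) [W.IsElliptic] [W.IsGloballyMinimal] (p : ℕ) [Fact p.Prime]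

/-- **X11b ∧ `p ≥ 5` ∧ surj(p): ONE unit Kurihara number at a prime Kolyvagin level forces
`#Ш(E/ℚ)(p) = 1`** (Kim 2026 Thm. 1.8 (6) + Cor. 1.6 at the semi-stable prime `p ∥ N`, named fact
`hKim`; period transfer `hϖ`; Gross–Zagier–Kolyvagin `hGZK` for the finiteness of `Ш`; modularity
`hmod` to read `r_an = 1` as `L(E,1) = 0`). Per pair. [cite: Kim2022StructureSelmer, Thm. 1.9 (6) (PDF p. 8), Cor. 1.6]
[cite: Mazur1978, Cor. 4.1] -/
theorem X11b.sha_primary_trivial_of_kuriharaNumber_ne_zero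
    (hKim : Kim2022_rankOne_card_sha_eq_one_of_kuriharaNumber_ne_zero)
    (hϖ : realPeriodRat_eq_unit_mul_plusPeriod_of_multiplicative)
    (hGZK : rank_eq_analyticRank_of_analyticRank_le_one) (hmod : hasEntireLFunction_rat)
    (hp : 5 ≤ p) (hX : ClassX11b W p) (hsurj : Surj W p)
    {N : ℕ} [NeZero N] (f : CuspForm (Gamma0 N) 2) (hf : IsNewformOf W f)
    (ℓ : ℕ) [Fact ℓ.Prime] (hℓ : Kato.IsKolyvaginPrime W p 1 ℓ)
    (hcyc : Nat.card {P : ((WeierstrassCurve.integralModelInt W).map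
        (Int.castRingHom (ZMod ℓ))).toAffine.Point // p • P = 0} ≤ p)
    (ψ : (ℓ' : ℕ) → (ZMod ℓ')ˣ →* Multiplicative (ZMod (p ^ 1)))
    (hψ : Function.Surjective (ψ ℓ)) (hδ : kuriharaNumber f (p ^ 1) ℓ ψ ≠ 0) :
    Nat.card (AddCommGroup.primaryComponent W.sha p) = 1 := by
  obtain ⟨hr, -, hmult, hirr⟩ := hX
  have hL : W.entireLFunction 1 = 0 := by
    by_contra hne
    have h0 := (W.analyticRank_eq_zero_iff_holds (hmod W)).mpr hne
    omega
  have hfin : Finite W.sha := (hGZK W (by rw [hr])).2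
  exact hKim W p hp (Or.inr hmult) hsurj hL hr hfin f hf (hϖ W p hp hmult hirr f hf) ℓ hℓ hcyc
    ψ hψ hδ

/-- **X11b ∧ `p ≥ 5` with `ρ̄_{E,p}` surjective and `ord_p #Ш_an = 0`: `BSD(E,p)` from PUBLISHED
theorems plus ONE Kurihara-number certificate at a prime level, at the multiplicative prime
`p ∥ N` itself** — the v5 census shape (`ClassX11b W p = (r_an = 1 ∧ p ≠ 2 ∧ Mult W p ∧ Irr W p)`,
no `Ram`/`sst` conjunct, so the former-C4 domain `sst ∧ ram(p)` is included). Inputs: Kim 2026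
Thm. 1.8 (6) + Cor. 1.6 (`hKim`), the period transfer at `p ∥ N` (`hϖ`), Gross–Zagier–Kolyvagin
(`hGZK`), modularity (`hmod`); per pair: `#Ш_an = q` with `ord_p q = 0`, the newform `f`, the
Kolyvagin prime `ℓ` with its cyclicity flag, `ψ`, `δ̃_ℓ ≢ 0 (mod p)`. No (ram), no anticyclotomic
main conjecture, no Heegner index. Per pair; NOT a class theorem (census `N < 2·10⁴`: the 7
semistable X11b pairs at `p ≥ 5` with `p ∤ ∏c_ℓ·#Ш_an` carry such a unit — module docstring).
[cite: Kim2022StructureSelmer, Thm. 1.9 (6) (PDF p. 8), Cor. 1.6] [cite: Miller2011LMS, Def. 1.1] -/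
theorem X11b.bsdp_of_kim_rankOne_of_kuriharaNumber_ne_zero
    (hKim : Kim2022_rankOne_card_sha_eq_one_of_kuriharaNumber_ne_zero)
    (hϖ : realPeriodRat_eq_unit_mul_plusPeriod_of_multiplicative)
    (hGZK : rank_eq_analyticRank_of_analyticRank_le_one) (hmod : hasEntireLFunction_rat)
    (hp : 5 ≤ p) (hX : ClassX11b W p) (hsurj : Surj W p)
    {q : ℚ} (hq : shaAn W = (q : ℂ)) (hv : padicValRat p q = 0)
    {N : ℕ} [NeZero N] (f : CuspForm (Gamma0 N) 2) (hf : IsNewformOf W f)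
    (ℓ : ℕ) [Fact ℓ.Prime] (hℓ : Kato.IsKolyvaginPrime W p 1 ℓ)
    (hcyc : Nat.card {P : ((WeierstrassCurve.integralModelInt W).map
        (Int.castRingHom (ZMod ℓ))).toAffine.Point // p • P = 0} ≤ p)
    (ψ : (ℓ' : ℕ) → (ZMod ℓ')ˣ →* Multiplicative (ZMod (p ^ 1)))
    (hψ : Function.Surjective (ψ ℓ)) (hδ : kuriharaNumber f (p ^ 1) ℓ ψ ≠ 0) : BSDp W p := by
  have hL : W.entireLFunction 1 = 0 := by
    by_contra hne
    have h0 := (W.analyticRank_eq_zero_iff_holds (hmod W)).mpr hne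
    have := hX.1
    omega
  exact Typed.bsdp_of_kim_rankOne_of_kuriharaNumber_ne_zero W p hKim hGZK hp (Or.inr hX.2.2.1)
    hsurj hL hX.1 hq hv f hf (hϖ W p hp hX.2.2.1 hX.2.2.2 f hf) ℓ hℓ hcyc ψ hψ hδ

end Summit.BirchSwinnertonDyer.Rank1Residual

end
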